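import Summits.Schanuel.Schanuel.Theorems.ZilberEacAxisLogExistence
import Summits.Schanuel.Schanuel.Theorems.ZilberEacPowerGrowthElimination
import Summits.Schanuel.Schanuel.Theorems.ZilberEacRealHyperplaneDensity
import HarnessLib

/-!
# The axis `x₂ = r₀x₀ + c` (`0 < r₀(deg F₀ + 1) < 1`, `r₀ ∉ ℚ`, `F₁ ≠ 0`): Zariski density

Zilber's Exponential-Algebraic Closedness, case ladder (host summit Schanuel, cell `pub-schanuel`,
seat 2, gen 15; HANDOFF O60 (i)).  For the explicit free, rotund, not linearly split family
`W = {x₂ = r₀x₀ + c, y₀ = x₀ + y₂F₀(y₂), y₁ = x₁ + y₂F₁(y₂)} ⊆ ℂ³ × ℂ³` with `r₀ ∉ ℚ`, `0 < r₀`,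
`r₀(deg F₀ + 1) < 1` and `F₁ ≠ 0` the exponential points are Zariski dense.  Method (the
LOGARITHMIC-FIBRE regime, `exists_solutions_axisLog`): the points have THREE power growth rates in
the coordinates `(y₀, x₁, y₂) = (inr 0, inl 1, inr 2)`: `log|y₀| = Re x₀ = log m + O(1)`,
`log|x₁| = log(2πk) + O(1) = β log m + O(1)` (the free label of the decoupled fibre),
`log|y₂| = r₀ log m + O(1)`; the weights `d₀ + βd₁ + r₀d₂` are injective on the support of any
given test polynomial for SOME admissible `β ∈ (0, r₀e₁)` (`exists_mem_injOn_affine`: the pair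
`(d₀ + r₀d₂, d₁)` determines `d` because `r₀ ∉ ℚ`), so THEOREM I⁽ᵏ⁾
(`unprojectedDense_of_powerGrowth_family`) applies.  This was the last piece of the axis `r₁ = 0`
(`unprojectedDense_polyFibredGraph_hyperplane_axis` did `r₀ < 0` and `r₀(deg F₀+1) > 1`).

* `axisLogWeights_injective`, **`unprojectedDense_polyFibredGraph_axisLog`**.

HONEST FRAMING: explicit families inside the OPEN cell `ECCell 3 2`; NOT Schanuel's conjecture;
EAC ⇏ SC.
-/

noncomputable section

open Complex MvPolynomial Filter Topology
open Literature.NumberTheory.Transcendental Literature.ModelTheory.Zilber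

set_option linter.dupNamespace false

namespace Summit.Schanuel.Schanuel.Theorems

section AxisLogDensity

/-- **The weights of the logarithmic-fibre regime are jointly injective**: `(d₀ + r₀d₂, d₁)`
determines `d ∈ ℕ³` when `r₀ ∉ ℚ`. [folklore] -/
theorem axisLogWeights_injective {r₀ : ℝ} (hirr : Irrational r₀) (d d' : Fin 3 →₀ ℕ)
    (h1 : (d 0 : ℝ) + r₀ * (d 2 : ℝ) = (d' 0 : ℝ) + r₀ * (d' 2 : ℝ)) (h2 : (d 1 : ℝ) = (d' 1 : ℝ)) :
    d = d' := by
  have h1' : d 1 = d' 1 := by exact_mod_cast h2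
  by_cases hb0 : ((d' 2 : ℝ) - d 2) = 0
  · have h2' : d 2 = d' 2 := by
      have : (d' 2 : ℝ) = d 2 := by linarith
      exact_mod_cast this.symm
    have h0' : d 0 = d' 0 := by
      have : (d 0 : ℝ) = d' 0 := by rw [h2'] at h1; linarith
      exact_mod_cast this
    ext i
    fin_cases i
    · exact h0'
    · exact h1'
    · exact h2'
  · exfalso
    have hr₀q : r₀ = ((d 0 : ℤ) - d' 0 : ℤ) / ((d' 2 : ℤ) - d 2 : ℤ) := by
      push_cast
      field_simp
      linarith
    have hbZ : ((d' 2 : ℤ) - d 2 : ℤ) ≠ 0 := by exact_mod_cast hb0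
    exact (irrational_iff_ne_rational r₀).1 hirr _ _ hbZ hr₀q

/-- **THEOREM (Zariski density on the axis, logarithmic-fibre regime).**  `r₀ ∉ ℚ`, `0 < r₀`,
`r₀(deg F₀ + 1) < 1`, `F₁ ≠ 0`, any `c` ⟹ `I(W ∩ Γ_exp) = I(W)` for
`W = {x₂ = r₀x₀ + c, y₀ = x₀ + y₂F₀(y₂), y₁ = x₁ + y₂F₁(y₂)}`.  See the module docstring. (new)
[cite: MantovaMasser2023, §1 p.5 (the open case dim π(V) = 2 in ℂ³×ℂˣ³)] -/
theorem unprojectedDense_polyFibredGraph_axisLog (F : Fin 2 → Polynomial ℂ) (hF1 : F 1 ≠ 0)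
    (r₀ : ℝ) (hr₀ : 0 < r₀) (hirr : Irrational r₀)
    (he₀ : r₀ * (((F 0).natDegree + 1 : ℕ) : ℝ) < 1) (c : ℂ) :
    UnprojectedDense (polyFibredGraph (hyperplanePoly ![r₀, 0] c) (fun j => X j)
      (fun j => (F j).toMvPolynomial 0)) := by
  classical
  set e₀ : ℕ := (F 0).natDegree + 1 with he₀def
  set e₁ : ℕ := (F 1).natDegree + 1 with he₁def
  have he₁ : 1 ≤ e₁ := by omega
  have he₁pos : (0 : ℝ) < e₁ := by exact_mod_cast (show 0 < e₁ by omega)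
  have hdeg0 : (F 0).natDegree < e₀ := by omega
  have hdeg1 : (F 1).natDegree < e₁ := by omega
  set A : Fin 2 → ℕ → ℂ := fun j i => (F j).coeff i with hA
  have ha₁ : A 1 (e₁ - 1) ≠ 0 := by
    simp only [hA, he₁def, Nat.add_sub_cancel, Polynomial.coeff_natDegree]
    exact Polynomial.leadingCoeff_ne_zero.2 hF1
  set r : Fin 2 → ℝ := ![r₀, 0] with hrdef
  -- the admissible exponents `β ∈ (0, r₀e₁)` form a neighbourhood of `r₀e₁/2`
  have hU : Set.Ioo 0 (r₀ * e₁) ∈ 𝓝 (r₀ * e₁ / 2) :=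
    Ioo_mem_nhds (by positivity) (by nlinarith)
  refine unprojectedDense_of_powerGrowth_family (isIrreducibleClosed_polyFibredGraph _ _ _)
    (by rw [zariskiDim_polyFibredGraph]) ![Sum.inr 0, Sum.inl 1, Sum.inr 2] fun H hH => ?_
  -- an admissible `β` with injective weights on the support of `H`
  obtain ⟨β, ⟨hβ, hβ₁⟩, hinj⟩ := exists_mem_injOn_affine H.support
    (fun d : Fin 3 →₀ ℕ => (d 0 : ℝ) + r₀ * (d 2 : ℝ)) (fun d : Fin 3 →₀ ℕ => (d 1 : ℝ))
    (fun d _ d' _ h1 h2 => axisLogWeights_injective hirr d d' h1 h2) hU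
  set γ : Fin 3 → ℝ := ![1, β, r₀] with hγdef
  have hw : (fun d : Fin 3 →₀ ℕ => ∑ i, (d i : ℝ) * γ i) =
      fun d => ((d 0 : ℝ) + r₀ * (d 2 : ℝ)) + β * (d 1 : ℝ) := by
    funext d
    rw [Fin.sum_univ_three]
    simp only [hγdef, Matrix.cons_val_zero, Matrix.cons_val_one, Matrix.cons_val_two,
      Matrix.tail_cons, Matrix.head_cons]
    ring
  refine ⟨γ, by rw [hw]; exact hinj, ?_⟩
  -- the solutions of the existence theorem
  obtain ⟨k, x, u, hk, hu, hx0, hx1, hℓ, hsol⟩ :=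
    exists_solutions_axisLog e₀ e₁ he₁ A ha₁ r₀ hr₀ he₀ c hβ hβ₁
  have hK1 : ∀ m : ℕ, 1 ≤ m → (1 : ℝ) ≤ k m := fun m hm =>
    one_le_of_rpow_le hβ (fun m => (hk m).1) hm
  set P3 : ℕ → Fin 3 ⊕ Fin 3 → ℂ := fun m =>
    pgParam (hyperplanePoly r c) (fun j => X j) (fun j => (F j).toMvPolynomial 0)
      (x m) (exp (∑ i, (r i : ℂ) * x m i + c)) with hP3
  set C₀ : ℝ := |Real.log ‖A 1 (e₁ - 1)‖| + (e₁ : ℝ) * (r₀ * |Real.log (2 * Real.pi)| + |c.re|) +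
    Real.pi with hC₀
  set E : ℝ := (|Real.log (2 * Real.pi)| + Real.log 2 + 1) * (1 + r₀) + ‖c‖ + 1 with hE
  have hl2π : 0 ≤ |Real.log (2 * Real.pi)| := abs_nonneg _
  have hlog2 : (0 : ℝ) ≤ Real.log 2 := Real.log_nonneg one_le_two
  -- the solution property in the shape of `pgParam_hyperplane_mem_expGraph`
  have hsolW : ∀ᶠ m in atTop, ∀ j : Fin 2, exp (x m j) = eval (x m) (X j) +
      exp (∑ i, (r i : ℂ) * x m i + c) * (F j).eval (exp (∑ i, (r i : ℂ) * x m i + c)) := by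
    filter_upwards [hsol] with m hm
    rw [Fin.forall_fin_two]
    refine ⟨?_, ?_⟩
    · rw [eval_X, Polynomial.eval_eq_sum_range' hdeg0]; exact hm.1
    · rw [eval_X, Polynomial.eval_eq_sum_range' hdeg1]; exact hm.2
  -- smallness of `u`
  have hu1 : ∀ᶠ m in atTop, ‖(u m).1‖ ≤ 1 ∧ ‖(u m).2‖ ≤ 1 := by
    have h := (tendsto_zero_iff_norm_tendsto_zero.1 hu).eventually (ge_mem_nhds zero_lt_one)
    filter_upwards [h] with m hm
    exact ⟨(norm_fst_le (u m)).trans hm, (norm_snd_le (u m)).trans hm⟩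
  -- the logarithmic head `Log(a₁Y^{e₁})` is small against the label `k ≍ m^β`
  have hsmall : ∀ᶠ m : ℕ in atTop, C₀ + (e₁ : ℝ) * r₀ * Real.log m + 1 ≤ Real.pi * k m := by
    have h1 := tendsto_const_div_label hβ (fun m => (hk m).1) (C₀ + 1)
    have h2 := (tendsto_log_nat_div_label hβ (fun m => (hk m).1)).const_mul ((e₁ : ℝ) * r₀)
    rw [mul_zero] at h2
    have h := h1.add h2
    rw [add_zero] at h
    filter_upwards [h.eventually (eventually_le_nhds Real.pi_pos), eventually_ge_atTop 1] with m hm hm1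
    have hkpos : (0 : ℝ) < k m := by linarith [hK1 m hm1]
    have : (C₀ + 1) / k m + (e₁ : ℝ) * r₀ * (Real.log m / k m) =
        (C₀ + (e₁ : ℝ) * r₀ * Real.log m + 1) / k m := by
      field_simp
      ring
    rw [this, div_le_iff₀ hkpos] at hm
    linarith
  -- real part of `x₀`
  have hrex0 : ∀ m : ℕ, (x m 0).re = Real.log (2 * Real.pi * m) + (u m).1.re := by
    intro m
    rw [hx0 m, Complex.add_re, Complex.add_re, re_log_two_pi_I_mul_natCast,
      show (2 * Real.pi * I * (m : ℂ)) = 2 * Real.pi * I * (((m : ℝ)) : ℂ) by norm_cast,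
      re_two_pi_I_mul_ofReal, add_zero]
  refine ⟨P3, fun m => Real.log m, E, Real.tendsto_log_atTop.comp tendsto_natCast_atTop_atTop,
    ?_, fun i => ?_⟩
  · filter_upwards [hsolW] with m hm
    exact ⟨pgParam_mem _ _ _ _ _, pgParam_hyperplane_mem_expGraph r c (fun j => X j) F hm⟩
  fin_cases i
  · -- `y₀ = e^{x₀}`: `log|y₀| = Re x₀ = log 2π + log m + Re u₀`
    simp only [hγdef, Fin.zero_eta, Matrix.cons_val_zero]
    filter_upwards [hsolW, hu1, eventually_ge_atTop 1] with m hm hum hm1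
    have hcoord : P3 m (Sum.inr 0) = exp (x m 0) := by
      have e0 : (Sum.inr 0 : Fin 3 ⊕ Fin 3) = Sum.inr (Fin.castSucc (0 : Fin 2)) := rfl
      simp only [hP3, e0, pgParam_inr, pMulParam_castSucc]
      rw [hm 0, MvPolynomial.eval_toMvPolynomial, Fin.cons_zero]
    refine ⟨by rw [hcoord]; exact Complex.exp_ne_zero _, ?_⟩
    have hu1r : |(u m).1.re| ≤ 1 := (Complex.abs_re_le_norm _).trans hum.1
    rw [hcoord, Complex.norm_exp, Real.log_exp, hrex0 m,
      Real.log_mul (by positivity) (by exact_mod_cast (show m ≠ 0 by omega)),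
      show Real.log (2 * Real.pi) + Real.log m + (u m).1.re - 1 * Real.log m =
        Real.log (2 * Real.pi) + (u m).1.re by ring]
    calc |Real.log (2 * Real.pi) + (u m).1.re| ≤ |Real.log (2 * Real.pi)| + |(u m).1.re| := abs_add_le _ _
      _ ≤ E := by rw [hE]; nlinarith [norm_nonneg c, hr₀]
  · -- `x₁ = 2πik(1 + g)` with `‖g‖ ≤ 1/2`
    simp only [hγdef, Fin.mk_one, Matrix.cons_val_one, Matrix.cons_val_zero]
    filter_upwards [hsmall, hu1, eventually_ge_atTop 1] with m hsm hum hm1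
    have hkpos : (0 : ℝ) < k m := by linarith [hK1 m hm1]
    have hkC : (2 * Real.pi * I * (k m : ℂ)) ≠ 0 :=
      mul_ne_zero Complex.two_pi_I_ne_zero (by exact_mod_cast hkpos.ne')
    have hn2 : ‖2 * Real.pi * I * (k m : ℂ)‖ = 2 * Real.pi * k m := norm_two_pi_I_mul_natCast (k m)
    have hcoord : P3 m (Sum.inl 1) = x m 1 := by
      have e1 : (Sum.inl 1 : Fin 3 ⊕ Fin 3) = Sum.inl (Fin.castSucc (1 : Fin 2)) := rfl
      simp only [hP3, e1, pgParam_inl_castSucc]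
    set Λ₁ : ℂ := Complex.log (A 1 (e₁ - 1) * exp ((r₀ : ℂ) *
      (Complex.log (2 * Real.pi * I * (m : ℂ)) + 2 * Real.pi * I * (m : ℂ)) + c) ^ e₁) with hΛ₁
    have hΛ₁le : ‖Λ₁‖ ≤ C₀ + (e₁ : ℝ) * r₀ * Real.log m := norm_log_axisTop_le hr₀ c ha₁ e₁ hm1
    have hμk : (2 * Real.pi * I * (k m : ℂ)) * (2 * Real.pi * I * (k m : ℂ))⁻¹ = 1 :=
      mul_inv_cancel₀ hkC
    set g : ℂ := (2 * Real.pi * I * (k m : ℂ))⁻¹ * (Λ₁ + (u m).2) with hgdef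
    have hx1g : x m 1 = 2 * Real.pi * I * (k m : ℂ) * (1 + g) := by
      rw [hx1 m, ← hΛ₁, hgdef]
      linear_combination (-(Λ₁ + (u m).2)) * hμk
    have hgle : ‖g‖ ≤ 1 / 2 := by
      rw [hgdef, norm_mul, norm_inv, hn2]
      have hnum : ‖Λ₁ + (u m).2‖ ≤ Real.pi * k m :=
        (norm_add_le _ _).trans (by linarith [hum.2])
      rw [inv_mul_le_iff₀ (by positivity)]
      linarith
    have hg1 : 1 / 2 ≤ ‖1 + g‖ := by
      have := norm_sub_norm_le (1 : ℂ) (-g)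
      rw [norm_one, norm_neg, sub_neg_eq_add] at this
      linarith
    have hg2 : ‖1 + g‖ ≤ 2 := by
      have := norm_add_le (1 : ℂ) g
      rw [norm_one] at this
      linarith
    have hnx : ‖x m 1‖ = 2 * Real.pi * k m * ‖1 + g‖ := by rw [hx1g, norm_mul, hn2]
    have hpos : 0 < ‖x m 1‖ := by rw [hnx]; positivity
    refine ⟨by rw [hcoord]; exact norm_pos_iff.1 hpos, ?_⟩
    rw [hcoord, hnx, Real.log_mul (by positivity) (by linarith), Real.log_mul (by positivity) hkpos.ne']
    have hl1 : |Real.log ‖1 + g‖| ≤ 1 := by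
      rw [abs_le]
      constructor
      · have := Real.log_le_log (by norm_num) hg1
        have h12 : Real.log (1 / 2) = -Real.log 2 := by rw [one_div, Real.log_inv]
        linarith [Real.log_two_lt_d9]
      · have := Real.log_le_log (by linarith) hg2
        linarith [Real.log_two_lt_d9]
    have hlogk : |Real.log (k m) - β * Real.log m| ≤ Real.log 2 := by
      obtain ⟨h1, h2⟩ := log_sandwich hβ hk hm1
      rw [abs_le]; constructor <;> linarith
    rw [show Real.log (2 * Real.pi) + Real.log (k m) + Real.log ‖1 + g‖ - β * Real.log m =
      Real.log (2 * Real.pi) + (Real.log (k m) - β * Real.log m) + Real.log ‖1 + g‖ by ring]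
    calc _ ≤ |Real.log (2 * Real.pi) + (Real.log (k m) - β * Real.log m)| + |Real.log ‖1 + g‖| :=
          abs_add_le _ _
      _ ≤ |Real.log (2 * Real.pi)| + |Real.log (k m) - β * Real.log m| + |Real.log ‖1 + g‖| := by
          gcongr; exact abs_add_le _ _
      _ ≤ |Real.log (2 * Real.pi)| + Real.log 2 + 1 := by linarith
      _ ≤ E := by rw [hE]; nlinarith [norm_nonneg c, hr₀]
  · -- `y₂ = e^{ℓ}`, `Re ℓ = r₀ Re x₀ + Re c`
    simp only [hγdef, Fin.reduceFinMk, Matrix.cons_val_two, Matrix.tail_cons, Matrix.head_cons]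
    filter_upwards [hu1, eventually_ge_atTop 1] with m hum hm1
    have hcoord : P3 m (Sum.inr 2) = exp (∑ i, (r i : ℂ) * x m i + c) := by
      have e2 : (Sum.inr 2 : Fin 3 ⊕ Fin 3) = Sum.inr (Fin.last 2) := rfl
      simp only [hP3, e2, pgParam_inr, pMulParam_last]
    refine ⟨by rw [hcoord]; exact Complex.exp_ne_zero _, ?_⟩
    have hu1r : |(u m).1.re| ≤ 1 := (Complex.abs_re_le_norm _).trans hum.1
    have hc : |c.re| ≤ ‖c‖ := Complex.abs_re_le_norm c
    rw [hcoord, Complex.norm_exp, Real.log_exp, hℓ m, Complex.add_re, Complex.re_ofReal_mul, hrex0 m,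
      Real.log_mul (by positivity) (by exact_mod_cast (show m ≠ 0 by omega)),
      show r₀ * (Real.log (2 * Real.pi) + Real.log m + (u m).1.re) + c.re - r₀ * Real.log m =
        r₀ * (Real.log (2 * Real.pi) + (u m).1.re) + c.re by ring]
    calc |r₀ * (Real.log (2 * Real.pi) + (u m).1.re) + c.re|
        ≤ |r₀ * (Real.log (2 * Real.pi) + (u m).1.re)| + |c.re| := abs_add_le _ _
      _ = r₀ * |Real.log (2 * Real.pi) + (u m).1.re| + |c.re| := by rw [abs_mul, abs_of_pos hr₀]
      _ ≤ r₀ * (|Real.log (2 * Real.pi)| + 1) + ‖c‖ := by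
          gcongr
          exact (abs_add_le _ _).trans (by linarith)
      _ ≤ E := by rw [hE]; nlinarith

end AxisLogDensity

end Summit.Schanuel.Schanuel.Theorems
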